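import Summits.AtomisticToContinuum.HydrodynamicLimit.Theses.AntiMazurCoboundaries
import Summits.AtomisticToContinuum.HydrodynamicLimit.Theorems.CellForecastPressureDecay.Negative.PerParticle

/-!
# Line `enskog-compensator-martingale` — checked skeleton for the crux `CellForecastPressureDecay`
(stmt-AtomisticToContinuum-13915, route AntiMazurCoboundaries, rank 6: the N-free core)

crux-plan seat `planner-cruxplan-stmt-AtomisticToContinuum-13915-enskog-compensator-m-0`, 2026-08-16.
Idea card `Cruxes/CellForecastPressureDecay/Ideas/enskog-compensator-martingale.md` (ideator 2; triage r1:
pass ×3 with two sharpenings, both made here, plus two corrections found while typing the composition — see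
"Statement hygiene" below); line card `Lines/enskog-compensator-martingale.md`.

## The line in one identity

Let `w` solve the linearised-Boltzmann Poisson equation `L w = g` (`L = hardSphereLinearizedOp`; solvable and
bounded EXACTLY because `g ⊥ span{1, v, |v|²} = ker L`, stub S1), let `ν > 0` be a compensation rate of the cell
and let `ṽᵢ(t)` be the range-`R` forecast velocity of particle `i` (`fvel` = `(localClusterState Ψ R t z i).2`).
The COMPENSATED COLLISION PROCESS (`compensated`)

  `M_t(z) := ∑ᵢ [ ν⁻¹ (w(ṽᵢ(t)) − w(ṽᵢ(0))) − ∫₀ᵗ g(ṽᵢ(s)) ds ]`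

satisfies IDENTICALLY (`crux_exponent_eq`)

  `2c ∑ᵢ T⁻¹∫₀ᵀ g(ṽᵢ) = (2c/T)·ν⁻¹ ∑ᵢ [w(ṽᵢ(T)) − w(ṽᵢ(0))] + θ·M_T`,   `θ := −2c/T`,

a bounded COBOUNDARY (`≤ 4bn/(νT) ≤ 4CbL³/T` pointwise when `|w| ≤ b`, `n ≤ CνL³`; no collision counts — the
jump sum telescopes per particle) plus a small multiple of the one object that carries the crux. The skeleton
proves (kernel-checked, `CellForecastPressureDecay_of`) that the crux follows from the ONE-SLAB TILT-STABILITY of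
`M` (stub S4 = the card's C⁺, sharpened):

  `E_P e^{θM_{t+Δ'}} ≤ e^{(Cθ²L³ + ηL³ + BL²)Δ'} · E_P e^{θM_t}`   (`|θ| ≤ 2/T`, `0 < Δ' ≤ Δ`, `t + Δ' ≤ T`),

iterated over `⌈T/Δ⌉` equal slabs from `M_0 ≡ 0` (`iterate_slabs`): `E_P e^{θM_T} ≤ e^{(Cθ²L³+ηL³+BL²)T}`
`≤ e^{4CL³/T + ηL³T + BL²T}`; with the coboundary the cell pressure is `≤ 4C(b+1)L³/T + ηTL³ + BL²T ≤ δL³` for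
`T ≥ 16C(b+1)/δ`, `η = δ/(4T)`, `L ≥ 2BT/δ` (`final_exponent_le`). No measurability is needed anywhere in the
composition (pointwise bounds + `lintegral_mono`); the cell law is a probability measure by the landed
`Theorems.CellForecastPressureDecay.isProbabilityMeasure_cellLaw` (σ ≤ 3/16, L ≥ 1, n ≤ 2L³; Disproof § 1).

## Stubs (registered; `sorry` only inside them) — hardest: `stub_tiltStability`

* `stub_poissonCorrector` (S1, M): Grad's sup-norm inverse — bounded continuous `w` with `L w = g`,
  `‖w‖∞ ≤ C₀‖g‖∞` (CIP1994 §7.2, Grad1963; tree: kernel `hardSphereLinearizedOp_eq_zero_iff` and gap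
  `le_neg_maxwellianInner_hardSphereLinearizedOp_of_orthogonal_holds` PROVED, no inverse yet). Same statement as
  `stub_chapmanEnskogInverse` of the sibling skeleton `KineticFluxLdDecay/Lines/dynkin-azuma-collision-innovations`
  (crux 10967) — one Theorems file discharges both.
* `stub_exactKinematicRates` (S2, M–L; the card's FIRST LEMMA `ExactKinematicRates`, = `KinematicRates σ`):
  equal-time Enskog kinematics of the canonical cell law is exact to first order in the slab length — against
  every bounded continuous functional `F` of the initial velocities, the increment `∑ᵢ[w(vᵢ(Δ)) − w(vᵢ(0))]`
  along the whole-cell isolated dynamics equals `Δ·c₂·∑_{i≠j} K_w(vᵢ,vⱼ)` (`pairKernel`; ONE static constant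
  `c₂`, the translation-averaged contact value of the canonical pair density — positions ⊥ velocities under
  `P`) up to `C(L³Δ² + L²Δ)` (two collisions on one particle; cube-boundary anisotropy).
* `stub_windowL2Rate` (S3, L; open at fixed σ — the `k = 2` sum rule; MD-supported, card job j009214; =
  `KinematicRates σ → WindowL2Rate σ`): the CENTRED L² crux WITH RATE, `inf_m E_P (∑ᵢ T⁻¹∫₀ᵀ g(ṽᵢ) − m)² ≤
  C L³/T` (card: `CompensatorL2Rate`), the ν- and w-free consequence of the SUMMED slab-covariance bound for the
  compensated increments — the repaired form of the card's `SlabCovarianceSummability`.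
* `stub_tiltStability` (S4 = C⁺, the bet; = `KinematicRates σ → WindowL2Rate σ → TiltStability σ`): one-slab
  stability of the log-MGF of `M` under the compensated-past tilt, as displayed above.

S2 and S3 are consumed by S4 as hypotheses, S2 by S3 likewise: the chain S2 → S3 → S4 → crux is kernel-checked,
with S1 supplying `w` to S4.

## Statement hygiene (triage sharpenings + what typing the composition forced)

1. (TRIAGE r1-1 (i)) The rate `ν` is ∃-quantified PER CELL (after `L, n, Ψ`), constrained only by
   `n ≤ CνL³`: the intended witness is `ν = max(ν_exact, 1/T)` — exact first-order compensation
   (`ν_exact = 2(n−1)c₂`) in bulk cells, UNDER-compensation in dilute cells `ρ ≲ 1/(σ²T)`, where with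
   `ν = ν_exact ∝ ρσ²` one collision in a near-empty cell would be an extensive jump `θν⁻¹Δw ≍ κL³/T`. Truth of
   S4 does not depend on the choice (even the raw window process is believed tilt-stable); provability does.
2. (TRIAGE r1-2/r1-3) A single summable `ψ` with `|E D_kD_l| ≤ L³ψ(l−k)` uniformly in the density is FALSE in
   the collisionless corner (`ψ(u) ≳ ΔVar g/(σ²u)`); only the SUMMED covariance bound is consumed, and S3 states
   its ν-free consequence.
3. (this seat) S3 must be CENTRED: with a free boundary the `O(ρL²v̄T)` particles of the rarefaction layer have a
   non-zero mean `E g(ṽᵢ) ≠ 0` (refuter g47-2 (b)), so the RAW second moment carries the squared mean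
   `≍ κ²ρ²L⁴T²` — super-extensive; `inf_m E(X − m)²` (= the variance, junk-free) is `O(L³/T)`.
4. (this seat) S4 needs TWO slacks besides `Cθ²L³Δ'`: `B L² Δ'` (`B` after `T`: first-order drift and
   fluctuations of the boundary layer; the lone-particle / collisionless `θ → 0` corner; `O(1)` cell-shell terms)
   and the EXTENSIVE `η L³ Δ'` with `∀ η > 0` before `R₀` (θ-linear drifts of interior forecasts that vanish
   only as `R → ∞`: the conserved energy/momentum shells of each particle's OWN isolated cluster bias
   `E g(ṽᵢ)` by `≍ κ/(ρR³)` after a mean free time, and missing inflow at the cluster edge reaches the centre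
   with probability `≍ e^{−R²/2T²}`). Both are invisible in the crux (linear in the exponent, `R₀` after `δ`)
   and both are threaded through the composition (`η = δ/4T`, `L ≥ 2BT/δ`).

## Disproof.lean (cdisprove cycle 1) used

`cellForecastPressureDecay_false_without_orthogonality` (landed p73681): honoured at S1 (`Orthogonal g` is the
solvability condition of `Lw = g`; a bounded solution forces `g ⊥ ker L`) and load-bearing again in S3 (for
`g = |v|² − 3` the window average overlaps the conserved cell energy and `Var ≍ n`, no rate). `…_false_perParticle`
(p74445) and the lone-particle lemmas (p73994): every bound is per VOLUME with `L₀` after `T`; the `n = 1` free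
flight (`M_t = −t g(v)`, `windowAverage_one`) satisfies S3 (`Var g ≤ CL³/T` once `L ≥ L₀(T)`) and S4 (increment
`≤ θ²Δ'(T+1)κ²e^{8κ} ≤ BL²Δ'`). § 7 near-miss (`∃κ` load-bearing on paper): the `∃ κ` of S4 — under the tilt
`e^{θM_t}`, `θ = −2c/T`, the cell's temperature shell `s` gains `c t n G''s²/T ≤ c n G'' s²` against the cost
`(3/4) n s²`, stable iff `κ < κ*`, and then contributes `O(Δ'/T)` per slab (inside `B L²`). § 1 frame:
`isProbabilityMeasure_cellLaw` used verbatim in the composition (`σ₀ ≤ 3/16`). READ-BACK (ii): the forecast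
flow enters only through `localClusterState` / `(Ψ n).flow` under `P ≪` Liouville (junk branch `P`-null); every
stub quantifies over CONTINUOUS bounded `g, w, F`; S2 is a Bochner `|∫…| ≤` (junk-0 cannot falsify it), S3 is a
centred `lintegral` with a free centre (no Bochner mean inside), S4 compares `lintegral`s. Negatives index (12
refuted statements, `ledger negatives`): none bears on this lever (13479's measurable-`g` junk is avoided by
continuity).
-/

noncomputable section

open MeasureTheory ProbabilityTheory Set Filter
open scoped ENNReal BigOperators InnerProductSpace
open Literature.Analysis.FluidPDE Literature.MathematicalPhysics.KineticTheory
open Literature.Analysis.UnboundedOperators (hardSphereLinearizedOp)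
open Summit.AtomisticToContinuum.HydrodynamicLimit.Theorems.CellForecastPressureDecay
  (cellRef isProbabilityMeasure_cellLaw vel_localClusterState_of_card_le_one)

namespace Summit.AtomisticToContinuum.HydrodynamicLimit.Cruxes.CellForecastPressureDecay.EnskogCompensatorMartingale

open Summit.AtomisticToContinuum.HydrodynamicLimit.Theses.AntiMazurCoboundaries (CellForecastPressureDecay)

/-! ## § 0 Frame (the crux's objects, named) -/

/-- Phase space of `n` spheres in `ℝ³` (positions in `V3`, free boundary). -/
abbrev Cell (n : ℕ) : Type := Config n (Fin 3) V3

/-- Euclidean hard-sphere flows of `k` spheres of diameter `σ` (the crux's cluster dynamics `Ψ k`). -/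
abbrev CFlow (σ : ℝ) (k : ℕ) : Type := HardSphereFlow (Euclidean.geometry (Fin 3)) σ k

/-- The canonical cell Gibbs law `P_{n,L}` of the crux: `n` spheres of diameter `σ`, hard-core uniform
positions in `[0,L]³`, i.i.d. standard Maxwellian velocities (`cellRef L = 1_{[0,L]³} ⊗ M`, landed). -/
def cellLaw (σ L : ℝ) (n : ℕ) (Ψ : (k : ℕ) → CFlow σ k) : Measure (Cell n) :=
  particleLaw (Ψ n) (canonicalDensity (Euclidean.geometry (Fin 3)) σ n (cellRef L))

/-- The cell law is literally the measure of the crux. -/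
theorem cellLaw_eq (σ L : ℝ) (n : ℕ) (Ψ : (k : ℕ) → CFlow σ k) :
    cellLaw σ L n Ψ = particleLaw (Ψ n) (canonicalDensity (Euclidean.geometry (Fin 3)) σ n
      (fun p => Set.indicator {x : V3 | ∀ k, x k ∈ Set.Icc (0 : ℝ) L} (fun _ => (1 : ℝ)) p.1 *
        globalMaxwellian p.2)) := rfl

/-- The **forecast velocity** `ṽᵢ(t)` of particle `i`: its velocity at time `t` when only its range-`R`
cluster is evolved under its isolated dynamics (`localClusterState`, exactly as in the crux). -/
def fvel {σ : ℝ} {n : ℕ} (Ψ : (k : ℕ) → CFlow σ k) (R t : ℝ) (z : Cell n) (i : Fin n) : V3 :=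
  (localClusterState Ψ R t z i).2

/-- The orthogonality clause of the crux: `g ⊥ span{1, v, |v|²}` in `L²(stdGaussian ℝ³)`. -/
def Orthogonal (g : V3 → ℝ) : Prop :=
  ∀ (c₀ c₂ : ℝ) (b : V3),
    ∫ v, g v * (c₀ + inner ℝ b v + c₂ * ‖v‖ ^ 2) ∂(stdGaussian V3) = 0

/-- The **Enskog–Boltzmann pair kernel** `K_w(v,u) = ∫_{S²} ((v−u)·ω)₊ (w(v') + w(u') − w(v) − w(u)) dω`:
the expected change of `w(v) + w(u)` in a collision of velocities `(v,u)` weighted by the kinematic rate.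
Its Maxwellian average in `u` is `(L w)(v)` by definition of `hardSphereLinearizedOp`
(`pairKernel_maxwellian`), so under the cell law (velocities i.i.d. Maxwellian) the one-body Hoeffding
projection of `∑_{i≠j} K_w(vᵢ,vⱼ)` is `2(n−1) ∑ᵢ (Lw)(vᵢ) = 2(n−1) ∑ᵢ g(vᵢ)`. -/
def pairKernel (w : V3 → ℝ) (v u : V3) : ℝ :=
  ∫ ω, hardSphereKernel (v, u) ω *
    (w (collide ω (v, u)).1 + w (collide ω (v, u)).2 - w v - w u) ∂sphereMeasure

/-- `∫ K_w(v,u) M(u) du = (L w)(v)` — definitionally. -/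
theorem pairKernel_maxwellian (w : V3 → ℝ) (v : V3) :
    ∫ u, pairKernel w v u ∂(stdGaussian V3) = hardSphereLinearizedOp w v := rfl

/-- The window integral `Aᵢ = ∫₀ᵀ g(ṽᵢ(t)) dt` of particle `i` (the crux's integrand is `2c ∑ᵢ T⁻¹ Aᵢ`). -/
def windowInt {σ : ℝ} {n : ℕ} (g : V3 → ℝ) (Ψ : (k : ℕ) → CFlow σ k) (R T : ℝ) (z : Cell n)
    (i : Fin n) : ℝ :=
  ∫ t in (0 : ℝ)..T, g (fvel Ψ R t z i)

/-- The **compensated collision process**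
`M_t = ∑ᵢ [ν⁻¹ (w(ṽᵢ(t)) − w(ṽᵢ(0))) − ∫₀ᵗ g(ṽᵢ(s)) ds]`: the jumps of the Boltzmann-level antiderivative
`ν⁻¹ ∑ᵢ w(ṽᵢ)` (`w(ṽᵢ)` is constant on free flights) minus their Boltzmann–Enskog compensator. -/
def compensated {σ : ℝ} {n : ℕ} (w : V3 → ℝ) (ν : ℝ) (g : V3 → ℝ) (Ψ : (k : ℕ) → CFlow σ k)
    (R t : ℝ) (z : Cell n) : ℝ :=
  ∑ i, (ν⁻¹ * (w (fvel Ψ R t z i) - w (fvel Ψ R 0 z i)) - windowInt g Ψ R t z i)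

/-- `M_0 ≡ 0`. -/
theorem compensated_zero {σ : ℝ} {n : ℕ} (w : V3 → ℝ) (ν : ℝ) (g : V3 → ℝ)
    (Ψ : (k : ℕ) → CFlow σ k) (R : ℝ) (z : Cell n) : compensated w ν g Ψ R 0 z = 0 := by
  simp [compensated, windowInt]

/-- Consistency with the landed lone-particle lemma (Disproof § 3, `Negative/LoneParticle`, p73994): for
`n = 1` every forecast is free flight, so `M_t = −t·g(v)` — the compensated process of a lone particle is the raw
drift, harmless only per VOLUME (this is how S3/S4 meet `cellForecastPressureDecay_false_perParticle`). -/
theorem compensated_lone {σ : ℝ} (w : V3 → ℝ) (ν : ℝ) (g : V3 → ℝ) (Ψ : (k : ℕ) → CFlow σ k) (R t : ℝ)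
    (z : Cell 1) : compensated w ν g Ψ R t z = -(t * g (z 0).2) := by
  have hcard : ∀ i : Fin 1, (rangeCluster (Euclidean.geometry (Fin 3)) R z i).card ≤ 1 :=
    fun i => (Finset.card_le_univ _).trans (by simp)
  simp only [compensated, windowInt, fvel, vel_localClusterState_of_card_le_one Ψ (hcard _),
    intervalIntegral.integral_const, sub_zero, smul_eq_mul, Fin.sum_univ_one, sub_self, mul_zero, zero_sub,
    Fin.isValue]

/-! ## § 1 The named obligations of the line (Props; the stubs below assert them) -/

/-- **Equal-time Enskog kinematics of the cell law at diameter `σ`** (card: `ExactKinematicRates`).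
For every bounded continuous `w` there are `C` and `L₀` such that for every cell `L ≥ L₀`, `n ≤ 2L³`, every
cluster dynamics `Ψ`, ONE static constant `c₂ ≥ 0` makes, for every continuous velocity functional `|F| ≤ 1`
and every slab length `Δ ∈ (0,1]`,
`|E_P[F(v(0)) · (∑ᵢ [w(vᵢ(Δ)) − w(vᵢ(0))] − Δ c₂ ∑_{i≠j} K_w(vᵢ,vⱼ))]| ≤ C (L³Δ² + L²Δ)`,
velocities evolved by the WHOLE-CELL isolated hard-sphere dynamics `(Ψ n).flow` (= every forecast of range
`≥ L√3`). Content: under `P` positions ⊥ velocities (product reference `1_{[0,L]³} ⊗ M`), so the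
velocity-conditional probability that the pair `(i,j)` collides in `[0,Δ]` with impact direction in `dω` is
`Δ c₂ ((vᵢ−vⱼ)·ω)₊ dω + O(Δ²)` with `c₂ σ⁻²` = translation-averaged contact value of the canonical pair
density (exchangeability); two collisions sharing a particle cost `O(L³Δ²)` (Gaussian moments; touching
chains are null), the cube-boundary anisotropy of the contact density costs `O(L²Δ)`. Equivalently:
`E_P |E_P[increment − compensator | v(0)]| ≤ C(L³Δ² + L²Δ)`. -/
def KinematicRates (σ : ℝ) : Prop :=
  ∀ (w : V3 → ℝ) (b : ℝ), Continuous w → (∀ v, |w v| ≤ b) →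
    ∃ C : ℝ, ∃ L₀ : ℝ, 0 < L₀ ∧ ∀ L : ℝ, L₀ ≤ L → ∀ n : ℕ, (n : ℝ) ≤ 2 * L ^ 3 →
      ∀ Ψ : (k : ℕ) → CFlow σ k, ∃ c₂ : ℝ, 0 ≤ c₂ ∧
        ∀ F : (Fin n → V3) → ℝ, Continuous F → (∀ x, |F x| ≤ 1) →
          ∀ Δ : ℝ, 0 < Δ → Δ ≤ 1 →
            |∫ z, F (fun i => (z i).2) *
                ((∑ i, (w ((Ψ n).flow Δ z i).2 - w (z i).2)) -
                  Δ * c₂ * ∑ i, ∑ j, if i = j then 0 else pairKernel w (z i).2 (z j).2)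
                ∂(cellLaw σ L n Ψ)| ≤
              C * (L ^ 3 * Δ ^ 2 + L ^ 2 * Δ)

/-- **The centred L² crux with rate `1/T` at diameter `σ`** (card: `CompensatorL2Rate`; the `k = 2` sum
rule in its ν-free form). For bounded continuous `g ⊥ span{1,v,|v|²}`:
`∃ C ∃ T₀ ∀ T ≥ T₀ ∃ R₀ ∀ R ≥ R₀ ∃ L₀ ∀ L ≥ L₀ ∀ n ≤ 2L³ ∀ Ψ ∃ m: E_P (∑ᵢ T⁻¹∫₀ᵀ g(ṽᵢ) − m)² ≤ C L³ / T`
(free centre `m`: the optimal one is the mean, so this IS the variance bound, stated junk-free; the RAW second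
moment is false — the free-boundary rarefaction layer has a non-zero mean of size `≍ κρL²T`, squared `≍ L⁴`).
Along the line it is the consequence (coboundary `O(L³)` + Cauchy–Schwarz) of the SUMMED slab-covariance bound
`∑_{0≤k<l<T/Δ} |Cov_P(D_k, D_l)| ≤ C' L³ T/Δ` for the unit-slab increments `D_k` of `compensated` with
`ν = max(ν_exact, 1/T)` (a single summable `ψ` uniform in the density is FALSE in the collisionless corner,
TRIAGE r1-2/r1-3; the summed form is all that is consumed). Consistency: bulk cells
`Var ≤ 2 n Var(g) τ_int(ρ)/T` for ALL `T` with `ρ τ_int(ρ) ≍ σ⁻²` density-free, so ONE `C ≍ Var(g)/σ²` serves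
every density and every `T ≥ 1` (Green–Kubo; `d = 3` tail `t^{-3/2}` integrable); collisionless dilute cells
`ρ ≤ 1/(cσ²T)`: `ρ Var(g) L³ ≤ Var(g) L³/(cσ²T)`; `n = 1` and the boundary layer (`O_T(L²)` after centring)
are paid by `L ≥ L₀(T)`; the cell's conserved shells contribute `O(1)`, the shells of the individual forecast
clusters `≍ L³ G''²/R³` (hence `R₀(T) ≳ T^{1/3}`), surviving hydrodynamic textures `O(L³ (ν_visc T)^{-3/2})` —
all second order, by orthogonality. Open at fixed `σ` (the cell twin of stmt-10952 WITH a rate); MD j009214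
(card): compensated variance flat to ±0.5 % over 0.28–8 t_mf, residual slab memory `|ρ_M| ≤ 0.016`. -/
def WindowL2Rate (σ : ℝ) : Prop :=
  ∀ (g : V3 → ℝ) (b : ℝ), Continuous g → (∀ v, |g v| ≤ b) → Orthogonal g →
    ∃ C : ℝ, ∃ T₀ : ℝ, 1 ≤ T₀ ∧ ∀ T : ℝ, T₀ ≤ T → ∃ R₀ : ℝ, 0 < R₀ ∧ ∀ R : ℝ, R₀ ≤ R →
      ∃ L₀ : ℝ, 0 < L₀ ∧ ∀ L : ℝ, L₀ ≤ L → ∀ n : ℕ, (n : ℝ) ≤ 2 * L ^ 3 →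
        ∀ Ψ : (k : ℕ) → CFlow σ k, ∃ m : ℝ,
          ∫⁻ z, ENNReal.ofReal ((∑ i, T⁻¹ * windowInt g Ψ R T z i - m) ^ 2) ∂(cellLaw σ L n Ψ) ≤
            ENNReal.ofReal (C * L ^ 3 / T)

/-- **One-slab tilt-stability of the compensated collision process at diameter `σ`** (card: `TiltStability`,
the transfer target C⁺, with the triage sharpenings and the two slacks of the module docstring). There is an
amplitude `κ > 0` such that for every continuous `|g| ≤ κ`, `g ⊥ span{1,v,|v|²}`, and every bounded continuous
solution `w` of `L w = g`:
`∃ C > 0 ∃ Δ ∈ (0,1] ∃ T₀ ≥ 1 ∀ T ≥ T₀ ∀ η > 0 ∃ B ≥ 0 ∃ R₀ ∀ R ≥ R₀ ∃ L₀ ∀ L ≥ L₀ ∀ n ≤ 2L³ ∀ Ψ ∃ ν > 0`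
with `n ≤ C ν L³` such that for `|θ| ≤ 2/T`, `0 ≤ t`, `0 < Δ' ≤ Δ`, `t + Δ' ≤ T`:

  `E_P exp(θ M_{t+Δ'}) ≤ exp((C θ² L³ + η L³ + B L²) Δ') · E_P exp(θ M_t)`,   `M = compensated w ν g Ψ R`.

THE RATE `ν` IS CHOSEN PER CELL and is NOT pinned to the Enskog collision rate: only `n ≤ CνL³` is imposed
(so `n/ν = O(L³)`: the coboundary is per-volume bounded), the intended witness being
`ν = max(ν_exact(σ,n,L), 1/T)` (exact first-order compensation in bulk cells, under-compensation in dilute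
cells, where a compensated jump `ν⁻¹Δw ≤ 2‖w‖T` keeps `θ·jump ≤ 4b`; TRIAGE r1-1 (i)). Pointwise
`|θ(M_{t+Δ'} − M_t)| ≤ 4bn + 2Δ'κn/T` whatever the number of collisions (the jump sum telescopes per particle),
so dense blobs cannot blow up the exponential moments (contrast the refuted ex-crux 14441). The EXTENSIVE part of
every slab increment of `log E e^{θM}` must be `θ²`-small up to `η`: at order `θ` the increment is the
predictable part — zero exactly on the periodic twin (invariance + `E g = 0`), `O(L³Δ'² + L²Δ')` at equal times
by `KinematicRates`, and on the forecast cell an interior drift vanishing only as `R → ∞` (cluster-shell bias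
`≍ κ/(ρR³)`, missing inflow `≍ e^{−R²/2T²}`: the `η L³ Δ'` slack, `R₀` after `η`); at order `θ²` it is the
summed slab covariance (`WindowL2Rate`, incl. the cluster-shell term `TG''²/R³ ≤ C` for `R ≥ R₀(T)`); the open
content is all orders under the weak (`|θ| ≤ 2/T`), explicitly structured tilt. `∃ κ`: under `e^{θM_t}`,
`θ = −2c/T`, the cell's temperature shell `s` gains `c t n G''(g) s²/T` against the uniformly convex cost
`(3/4) n s²` — bounded per slab (`O(Δ'/T)`, inside `B L²`) iff `κ < κ*` (Disproof § 7; the card's threshold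
mechanism). `B L² Δ'` also pays the rarefaction layer of the free boundary (`O(ρL²v̄T)` particles with
`E g(ṽ) ≠ 0`, refuter g47-2 (b)), the lone particle (`M_t = −t g(v)`: increment `≤ θ²Δ'(T+1)κ²e^{8κ}`), and
fast-velocity tails. Local in time: one slab `Δ ≲ 0.1 t_mf(ρ = 2)`, few-collision dynamics at fixed σ; the
horizon enters only through `θ ∝ 1/T`. Arena for a proof: the periodic twin (true torus flow, `P` exactly
invariant, kinematics exact at the start of EVERY slab), then transfer to the free-boundary forecast cell by
finite speed of influence in LD currency at free range `R₀(T)` (`≳ T³` by the relay count of TRIAGE r1-2/3 —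
affordable because `R₀` is chosen after `T`; the LD form of the route's `InfluenceLocality`, 13916, has exactly
this quantifier order). -/
def TiltStability (σ : ℝ) : Prop :=
  ∃ κ : ℝ, 0 < κ ∧ ∀ g : V3 → ℝ, Continuous g → (∀ v, |g v| ≤ κ) → Orthogonal g →
    ∀ (w : V3 → ℝ) (b : ℝ), Continuous w → (∀ v, |w v| ≤ b) → hardSphereLinearizedOp w = g →
      ∃ C : ℝ, 0 < C ∧ ∃ Δ : ℝ, 0 < Δ ∧ Δ ≤ 1 ∧ ∃ T₀ : ℝ, 1 ≤ T₀ ∧ ∀ T : ℝ, T₀ ≤ T → ∀ η : ℝ, 0 < η →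
        ∃ B : ℝ, 0 ≤ B ∧ ∃ R₀ : ℝ, 0 < R₀ ∧ ∀ R : ℝ, R₀ ≤ R →
          ∃ L₀ : ℝ, 0 < L₀ ∧ ∀ L : ℝ, L₀ ≤ L → ∀ n : ℕ, (n : ℝ) ≤ 2 * L ^ 3 →
            ∀ Ψ : (k : ℕ) → CFlow σ k, ∃ ν : ℝ, 0 < ν ∧ (n : ℝ) ≤ C * ν * L ^ 3 ∧
              ∀ θ : ℝ, |θ| ≤ 2 / T → ∀ t Δ' : ℝ, 0 ≤ t → 0 < Δ' → Δ' ≤ Δ → t + Δ' ≤ T →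
                ∫⁻ z, ENNReal.ofReal (Real.exp (θ * compensated w ν g Ψ R (t + Δ') z))
                    ∂(cellLaw σ L n Ψ) ≤
                  ENNReal.ofReal (Real.exp ((C * θ ^ 2 * L ^ 3 + η * L ^ 3 + B * L ^ 2) * Δ')) *
                    ∫⁻ z, ENNReal.ofReal (Real.exp (θ * compensated w ν g Ψ R t z))
                      ∂(cellLaw σ L n Ψ)

/-! ## § 2 The stubs (registered obligations of the line; `sorry` only here) -/

/-- **S1 · bounded Poisson corrector** (Grad's sup-norm theory of `L⁻¹`; CIP1994 §7.2, Grad1963): every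
bounded continuous `g ⊥ span{1, v, |v|²}` has a bounded continuous pre-image `w` under the in-tree linearised
hard-sphere operator, `L w = g` pointwise, `‖w‖∞ ≤ C₀ ‖g‖∞` (`w = (Kw − g)/ν(v)`, `ν(v) ≥ ν₀`, `K` compact and
`L∞`-improving; the `L²_M` solution exists by the PROVED gap). Solvability is EXACTLY the orthogonality clause
(Fredholm alternative, `ker L = collisionInvariants`): the line honours
`cellForecastPressureDecay_false_without_orthogonality` here. Same statement as the sibling line's
`stub_chapmanEnskogInverse` (crux 10967). -/
theorem stub_poissonCorrector :
    ∃ C₀ : ℝ, 0 < C₀ ∧ ∀ (g : V3 → ℝ) (b : ℝ), Continuous g → (∀ v, |g v| ≤ b) → Orthogonal g →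
      ∃ w : V3 → ℝ, Continuous w ∧ (∀ v, |w v| ≤ C₀ * b) ∧ hardSphereLinearizedOp w = g := by
  sorry

/-- **S2 · equal-time Enskog kinematics is exact for the cell law** (the card's first lemma; provable-grade
with the tree's trajectory structure `IsHardSphereTrajectory` — finitely many collisions on compact
intervals — and `integral_canonicalDensity`): `KinematicRates σ` for all small `σ`. -/
theorem stub_exactKinematicRates :
    ∃ σ₀ : ℝ, 0 < σ₀ ∧ ∀ σ : ℝ, 0 < σ → σ < σ₀ → KinematicRates σ := by
  sorry

/-- **S3 · the centred L² crux with rate** (`k = 2` sum rule): given exact equal-time kinematics, the window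
variance is `O(L³/T)` — the summed slab covariances of the compensated increments are `O(L³)` per slab
(direct re-encounters: a small-ball / anti-concentration bound for the relative displacement of two tagged
spheres, integrable in the gap `u` exactly because `d = 3` — kernel (2) of `NoDensityExpansionBarrierNarrow`;
rings: fixed-ε duality over ONE gap at a time with a merely summable target, polynomial losses in `u`
affordable) and the coboundary is `O(L³)`. Open at fixed `σ`; strictly weaker than S4; the natural first HARD
milestone (and MD-testable: k = 2 of the card's falsifier (ii)). -/
theorem stub_windowL2Rate :
    ∃ σ₀ : ℝ, 0 < σ₀ ∧ ∀ σ : ℝ, 0 < σ → σ < σ₀ → KinematicRates σ → WindowL2Rate σ := by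
  sorry

/-- **S4 · THE BET (C⁺) · one-slab tilt-stability of the compensated collision process**: given exact
equal-time kinematics (the predictable part) and the `k = 2` sum rule (the `θ²` coefficient), the log-MGF of
the next short-slab increment of `M` under the measure tilted by the compensated PAST grows at most like
`(Cθ²L³ + ηL³ + BL²)Δ'`, for tilts `|θ| ≤ 2/T` and amplitudes `κ < κ*`. Stronger than the crux (it yields the
RATE `1/T`); the composition below is the card's `tiltStability_imp`, now kernel-checked. -/
theorem stub_tiltStability :
    ∃ σ₀ : ℝ, 0 < σ₀ ∧ ∀ σ : ℝ, 0 < σ → σ < σ₀ →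
      KinematicRates σ → WindowL2Rate σ → TiltStability σ := by
  sorry

/-! ## § 3 Composition: the stubs imply the crux (kernel-checked; no `sorry` from here on) -/

section Composition

/-- Slab iteration: a multiplicative one-slab bound for all slab lengths `≤ Δ` integrates to
`E e^{M_T} ≤ e^{aT}` from `M_0 ≡ 0` (tile `[0,T]` by `⌈T/Δ⌉` equal slabs). -/
theorem iterate_slabs {α : Type*} [MeasurableSpace α] (μ : Measure α) [IsProbabilityMeasure μ]
    (M : ℝ → α → ℝ) (hM0 : ∀ z, M 0 z = 0) {a Δ T : ℝ} (hΔ : 0 < Δ) (hT : 0 < T)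
    (hstep : ∀ t Δ' : ℝ, 0 ≤ t → 0 < Δ' → Δ' ≤ Δ → t + Δ' ≤ T →
      ∫⁻ z, ENNReal.ofReal (Real.exp (M (t + Δ') z)) ∂μ ≤
        ENNReal.ofReal (Real.exp (a * Δ')) * ∫⁻ z, ENNReal.ofReal (Real.exp (M t z)) ∂μ) :
    ∫⁻ z, ENNReal.ofReal (Real.exp (M T z)) ∂μ ≤ ENNReal.ofReal (Real.exp (a * T)) := by
  set m : ℕ := ⌈T / Δ⌉₊ with hm
  have hm1 : 1 ≤ m := Nat.one_le_ceil_iff.2 (div_pos hT hΔ)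
  have hmpos : (0 : ℝ) < m := by exact_mod_cast hm1
  set D : ℝ := T / m with hD
  have hDpos : 0 < D := div_pos hT hmpos
  have hDΔ : D ≤ Δ := by
    rw [hD, div_le_iff₀ hmpos]
    have h1 : T / Δ ≤ m := Nat.le_ceil _
    rw [div_le_iff₀ hΔ] at h1
    linarith [mul_comm Δ (m : ℝ)]
  have hmD : (m : ℝ) * D = T := by
    rw [hD]; field_simp
  -- induction over the slabs
  have key : ∀ k : ℕ, k ≤ m →
      ∫⁻ z, ENNReal.ofReal (Real.exp (M (k * D) z)) ∂μ ≤
        ENNReal.ofReal (Real.exp (a * D * k)) := by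
    intro k
    induction k with
    | zero =>
      intro _
      simp [hM0]
    | succ k ih =>
      intro hk
      have hk' : k ≤ m := Nat.le_of_succ_le hk
      have hklt : (k : ℝ) + 1 ≤ m := by exact_mod_cast hk
      have ht0 : 0 ≤ (k : ℝ) * D := by positivity
      have htT : (k : ℝ) * D + D ≤ T := by
        calc (k : ℝ) * D + D = ((k : ℝ) + 1) * D := by ring
          _ ≤ m * D := by gcongr
          _ = T := hmD
      have hs := hstep ((k : ℝ) * D) D ht0 hDpos hDΔ htT
      have hcast : ((k + 1 : ℕ) : ℝ) * D = (k : ℝ) * D + D := by push_cast; ring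
      rw [hcast]
      refine hs.trans ?_
      calc ENNReal.ofReal (Real.exp (a * D)) * ∫⁻ z, ENNReal.ofReal (Real.exp (M (k * D) z)) ∂μ
          ≤ ENNReal.ofReal (Real.exp (a * D)) * ENNReal.ofReal (Real.exp (a * D * k)) := by
            gcongr
            exact ih hk'
        _ = ENNReal.ofReal (Real.exp (a * D * ((k + 1 : ℕ) : ℝ))) := by
            rw [← ENNReal.ofReal_mul (Real.exp_pos _).le, ← Real.exp_add]
            congr 1
            push_cast
            ring_nf
  have hfin := key m le_rfl
  rw [hmD] at hfin
  refine hfin.trans (le_of_eq ?_)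
  congr 2
  calc a * D * m = a * (m * D) := by ring
    _ = a * T := by rw [hmD]

variable {σ : ℝ} {n : ℕ}

/-- THE IDENTITY OF THE LINE (pointwise, exact): with `θ = −2c/T`,
`2c ∑ᵢ T⁻¹ Aᵢ = (2c/T) · ν⁻¹ ∑ᵢ [w(ṽᵢ(T)) − w(ṽᵢ(0))] + θ · M_T`. -/
theorem crux_exponent_eq (w : V3 → ℝ) (ν : ℝ) (g : V3 → ℝ) (Ψ : (k : ℕ) → CFlow σ k) (R : ℝ)
    {T : ℝ} (hT : T ≠ 0) (c : ℝ) (z : Cell n) :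
    2 * c * ∑ i, T⁻¹ * windowInt g Ψ R T z i =
      (2 * c / T) * (ν⁻¹ * ∑ i, (w (fvel Ψ R T z i) - w (fvel Ψ R 0 z i))) +
        (-(2 * c / T)) * compensated w ν g Ψ R T z := by
  simp only [compensated, Finset.sum_sub_distrib, ← Finset.mul_sum]
  field_simp
  ring

/-- The coboundary is bounded pointwise: `|ν⁻¹ ∑ᵢ [w(ṽᵢ(T)) − w(ṽᵢ(0))]| ≤ ν⁻¹ · 2bn`. -/
theorem abs_coboundary_le (w : V3 → ℝ) {b : ℝ} (hwb : ∀ v, |w v| ≤ b) {ν : ℝ} (hν : 0 < ν)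
    (Ψ : (k : ℕ) → CFlow σ k) (R T : ℝ) (z : Cell n) :
    |ν⁻¹ * ∑ i, (w (fvel Ψ R T z i) - w (fvel Ψ R 0 z i))| ≤ ν⁻¹ * (2 * b * n) := by
  rw [abs_mul, abs_of_pos (inv_pos.2 hν)]
  refine mul_le_mul_of_nonneg_left ?_ (inv_pos.2 hν).le
  calc |∑ i, (w (fvel Ψ R T z i) - w (fvel Ψ R 0 z i))|
      ≤ ∑ i, |w (fvel Ψ R T z i) - w (fvel Ψ R 0 z i)| := Finset.abs_sum_le_sum_abs _ _
    _ ≤ ∑ _i : Fin n, 2 * b := Finset.sum_le_sum fun i _ => by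
        have h1 := hwb (fvel Ψ R T z i)
        have h2 := hwb (fvel Ψ R 0 z i)
        have h3 := abs_sub (w (fvel Ψ R T z i)) (w (fvel Ψ R 0 z i))
        linarith
    _ = 2 * b * n := by simp [Finset.sum_const, Finset.card_univ, mul_comm]

/-- Threading the thresholds: the final exponent is `≤ δ L³`. -/
theorem final_exponent_le {C b B T L δ θ η : ℝ} (hC : 0 < C) (hδ : 0 < δ) (hT1 : 1 ≤ T) (hL1 : 1 ≤ L)
    (hTδ : 16 * C * (b + 1) / δ ≤ T) (hLB : 2 * B * T / δ ≤ L) (hθ : θ ^ 2 ≤ 4 / T ^ 2)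
    (hηT : η * T ≤ δ / 4) :
    4 * C * b * L ^ 3 / T + (C * θ ^ 2 * L ^ 3 + η * L ^ 3 + B * L ^ 2) * T ≤ δ * L ^ 3 := by
  have hTpos : 0 < T := one_pos.trans_le hT1
  have hLpos : 0 < L := one_pos.trans_le hL1
  have hL3 : 0 < L ^ 3 := pow_pos hLpos 3
  have h1 : 16 * C * (b + 1) ≤ T * δ := (div_le_iff₀ hδ).1 hTδ
  have h2 : 2 * B * T ≤ L * δ := (div_le_iff₀ hδ).1 hLB
  -- the θ²-term
  have hθT : C * θ ^ 2 * L ^ 3 * T ≤ 4 * C * L ^ 3 / T := by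
    rw [le_div_iff₀ hTpos]
    have : θ ^ 2 * T ^ 2 ≤ 4 := by
      have := (le_div_iff₀ (pow_pos hTpos 2)).1 hθ
      linarith
    nlinarith [mul_nonneg hC.le hL3.le]
  -- the two `1/T` terms
  have hmain : 4 * C * b * L ^ 3 / T + 4 * C * L ^ 3 / T ≤ δ / 4 * L ^ 3 := by
    rw [← add_div, div_le_iff₀ hTpos]
    nlinarith [mul_nonneg hC.le hL3.le]
  -- the forecast slack
  have hηterm : η * L ^ 3 * T ≤ δ / 4 * L ^ 3 := by nlinarith
  -- the boundary term
  have hbdry : B * L ^ 2 * T ≤ δ / 2 * L ^ 3 := by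
    have hL2 : 0 ≤ L ^ 2 := sq_nonneg L
    nlinarith
  nlinarith

/-- **The crux from the stubs** (the card's `tiltStability_imp`, kernel-checked). Order of choices (no loop):
`σ₀` = min of the stubs' thresholds and `3/16` (probability measure); `κ` from S4 (fed S2, S3); given `g`: `w`
from S1 (`b = C₀κ`), `C, Δ, T₀` from S4; given `δ`: `T = max(T₀, 16C(b+1)/δ)`, `η = δ/(4T)`; `B, R₀` from S4;
given `R`: `L₀ = max(L₀(S4), 1, 2BT/δ)`; given `L, n, Ψ`: `ν` from S4; given `c`: `θ = −2c/T`, identity +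
coboundary pointwise, slab iteration, thresholds. -/
theorem CellForecastPressureDecay_of : CellForecastPressureDecay := by
  obtain ⟨C₀, hC₀, hS1⟩ := stub_poissonCorrector
  obtain ⟨σ₂, hσ₂, hS2⟩ := stub_exactKinematicRates
  obtain ⟨σ₃, hσ₃, hS3⟩ := stub_windowL2Rate
  obtain ⟨σ₄, hσ₄, hS4⟩ := stub_tiltStability
  refine ⟨min (min σ₂ σ₃) (min σ₄ (3 / 16)), by positivity, fun σ hσ hσlt => ?_⟩
  have h2 : σ < σ₂ := hσlt.trans_le ((min_le_left _ _).trans (min_le_left _ _))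
  have h3 : σ < σ₃ := hσlt.trans_le ((min_le_left _ _).trans (min_le_right _ _))
  have h4 : σ < σ₄ := hσlt.trans_le ((min_le_right _ _).trans (min_le_left _ _))
  have h316 : σ ≤ 3 / 16 := (hσlt.trans_le ((min_le_right _ _).trans (min_le_right _ _))).le
  have hK : KinematicRates σ := hS2 σ hσ h2
  have hL2 : WindowL2Rate σ := hS3 σ hσ h3 hK
  obtain ⟨κ, hκ, hTS⟩ := hS4 σ hσ h4 hK hL2
  refine ⟨κ, hκ, fun g hgc hgκ horth δ hδ => ?_⟩
  -- the Poisson corrector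
  obtain ⟨w, hwc, hwb, hLw⟩ := hS1 g κ hgc hgκ horth
  set b : ℝ := C₀ * κ with hbdef
  have hb : 0 ≤ b := by positivity
  obtain ⟨C, hC, Δ, hΔ, hΔ1, T₀, hT₀, hT⟩ := hTS g hgc hgκ horth w b hwc hwb hLw
  -- the horizon
  set T : ℝ := max T₀ (16 * C * (b + 1) / δ) with hTdef
  have hTT₀ : T₀ ≤ T := le_max_left _ _
  have hT1 : 1 ≤ T := hT₀.trans hTT₀
  have hTpos : 0 < T := one_pos.trans_le hT1
  have hTδ : 16 * C * (b + 1) / δ ≤ T := le_max_right _ _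
  -- the forecast slack `η L³` with `η T = δ/4`
  set η : ℝ := δ / (4 * T) with hηdef
  have hη : 0 < η := by positivity
  have hηT : η * T ≤ δ / 4 := by
    rw [hηdef]; field_simp; rfl
  obtain ⟨B, hB, R₀, hR₀, hR⟩ := hT T hTT₀ η hη
  refine ⟨T, hTpos, R₀, hR₀, fun R hRR => ?_⟩
  obtain ⟨L₁, hL₁, hL⟩ := hR R hRR
  refine ⟨max L₁ (max 1 (2 * B * T / δ)), lt_max_of_lt_left hL₁, fun L hLL n hn Ψ c hc => ?_⟩
  have hLL₁ : L₁ ≤ L := (le_max_left _ _).trans hLL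
  have hL1 : 1 ≤ L := ((le_max_left _ _).trans (le_max_right _ _)).trans hLL
  have hLB : 2 * B * T / δ ≤ L := ((le_max_right _ _).trans (le_max_right _ _)).trans hLL
  obtain ⟨ν, hν, hnν, hslab⟩ := hL L hLL₁ n hn Ψ
  -- the cell law is a probability measure (landed Disproof § 1)
  haveI : IsProbabilityMeasure (cellLaw σ L n Ψ) := isProbabilityMeasure_cellLaw h316 hL1 hn (Ψ n)
  -- the tilt
  set θ : ℝ := -(2 * c / T) with hθdef
  have hcabs : |c| ≤ 1 := hc
  have hθabs : |θ| ≤ 2 / T := by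
    rw [hθdef, abs_neg, abs_div, abs_mul, abs_of_pos (by norm_num : (0 : ℝ) < 2), abs_of_pos hTpos]
    gcongr
    linarith
  have hθsq : θ ^ 2 ≤ 4 / T ^ 2 := by
    have h1 : θ ^ 2 = |θ| ^ 2 := (sq_abs θ).symm
    rw [h1, show (4 : ℝ) / T ^ 2 = (2 / T) ^ 2 by ring]
    exact pow_le_pow_left₀ (abs_nonneg θ) hθabs 2
  -- slab iteration for `θ M`
  have hiter : ∫⁻ z, ENNReal.ofReal (Real.exp (θ * compensated w ν g Ψ R T z)) ∂(cellLaw σ L n Ψ) ≤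
      ENNReal.ofReal (Real.exp ((C * θ ^ 2 * L ^ 3 + η * L ^ 3 + B * L ^ 2) * T)) :=
    iterate_slabs (cellLaw σ L n Ψ) (fun t z => θ * compensated w ν g Ψ R t z)
      (fun z => by simp [compensated_zero]) hΔ hTpos
      (fun t Δ' ht hΔ' hΔ'Δ htT => hslab θ hθabs t Δ' ht hΔ' hΔ'Δ htT)
  -- pointwise: identity + coboundary
  have hnν : (n : ℝ) / ν ≤ C * L ^ 3 := by
    rw [div_le_iff₀ hν]
    calc (n : ℝ) ≤ C * ν * L ^ 3 := hnν
      _ = C * L ^ 3 * ν := by ring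
  have hpt : ∀ z : Cell n,
      ENNReal.ofReal (Real.exp (2 * c * ∑ i : Fin n, T⁻¹ * ∫ t in (0 : ℝ)..T,
          g (localClusterState Ψ R t z i).2)) ≤
        ENNReal.ofReal (Real.exp (4 * C * b * L ^ 3 / T)) *
          ENNReal.ofReal (Real.exp (θ * compensated w ν g Ψ R T z)) := by
    intro z
    rw [← ENNReal.ofReal_mul (Real.exp_pos _).le, ← Real.exp_add]
    refine ENNReal.ofReal_le_ofReal (Real.exp_le_exp.2 ?_)
    have hid := crux_exponent_eq w ν g Ψ R hTpos.ne' c z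
    have hco := abs_coboundary_le w hwb hν Ψ R T z
    have hcob : (2 * c / T) * (ν⁻¹ * ∑ i, (w (fvel Ψ R T z i) - w (fvel Ψ R 0 z i))) ≤
        4 * C * b * L ^ 3 / T := by
      have h1 : |(2 * c / T) * (ν⁻¹ * ∑ i, (w (fvel Ψ R T z i) - w (fvel Ψ R 0 z i)))| ≤
          (2 / T) * (ν⁻¹ * (2 * b * n)) := by
        rw [abs_mul]
        refine mul_le_mul ?_ hco (abs_nonneg _) (by positivity)
        rw [abs_div, abs_mul, abs_of_pos (by norm_num : (0 : ℝ) < 2), abs_of_pos hTpos]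
        exact div_le_div_of_nonneg_right (by linarith) hTpos.le
      have h2 : (2 / T) * (ν⁻¹ * (2 * b * n)) ≤ 4 * C * b * L ^ 3 / T := by
        have h3 : ν⁻¹ * (2 * b * n) = 2 * b * (n / ν) := by
          field_simp
        rw [h3, div_mul_eq_mul_div, div_le_div_iff_of_pos_right hTpos]
        nlinarith [mul_le_mul_of_nonneg_left hnν (by positivity : (0 : ℝ) ≤ 2 * b)]
      exact (le_abs_self _).trans (h1.trans h2)
    have hw : (2 * c * ∑ i : Fin n, T⁻¹ * ∫ t in (0 : ℝ)..T, g (localClusterState Ψ R t z i).2) =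
        2 * c * ∑ i, T⁻¹ * windowInt g Ψ R T z i := rfl
    rw [hw, hid]
    linarith
  -- integrate and thread the thresholds
  rw [← cellLaw_eq]
  calc ∫⁻ z, ENNReal.ofReal (Real.exp (2 * c * ∑ i : Fin n, T⁻¹ * ∫ t in (0 : ℝ)..T,
          g (localClusterState Ψ R t z i).2)) ∂(cellLaw σ L n Ψ)
      ≤ ∫⁻ z, ENNReal.ofReal (Real.exp (4 * C * b * L ^ 3 / T)) *
          ENNReal.ofReal (Real.exp (θ * compensated w ν g Ψ R T z)) ∂(cellLaw σ L n Ψ) :=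
        lintegral_mono hpt
    _ = ENNReal.ofReal (Real.exp (4 * C * b * L ^ 3 / T)) *
          ∫⁻ z, ENNReal.ofReal (Real.exp (θ * compensated w ν g Ψ R T z)) ∂(cellLaw σ L n Ψ) :=
        lintegral_const_mul' _ _ ENNReal.ofReal_ne_top
    _ ≤ ENNReal.ofReal (Real.exp (4 * C * b * L ^ 3 / T)) *
          ENNReal.ofReal (Real.exp ((C * θ ^ 2 * L ^ 3 + η * L ^ 3 + B * L ^ 2) * T)) := by
        gcongr
    _ = ENNReal.ofReal (Real.exp (4 * C * b * L ^ 3 / T +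
          (C * θ ^ 2 * L ^ 3 + η * L ^ 3 + B * L ^ 2) * T)) := by
        rw [← ENNReal.ofReal_mul (Real.exp_pos _).le, ← Real.exp_add]
    _ ≤ ENNReal.ofReal (Real.exp (δ * L ^ 3)) :=
        ENNReal.ofReal_le_ofReal (Real.exp_le_exp.2
          (final_exponent_le hC hδ hT1 hL1 hTδ hLB hθsq hηT))

end Composition

end Summit.AtomisticToContinuum.HydrodynamicLimit.Cruxes.CellForecastPressureDecay.EnskogCompensatorMartingale
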